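import Literature.Topology.FourManifolds.GluingCharts
import HarnessLib

/-!
# Change of model space: transporting an atlas along a homeomorphism of the models

A charted space `M` with charts valued in `H` becomes a charted space with charts valued in `E'`
by composing every chart with a fixed homeomorphism `f : H ≃ₜ E'` of the model spaces; when `f`
is a `C^n` diffeomorphism between the models `(H, I)` and `(E', 𝓘(𝕜, E'))` (typically a
continuous linear isomorphism `E ≃L[𝕜] E'` of model vector spaces, or `E × F ≃L[𝕜] E'`), the
transported atlas is again `C^n` and the identity map is a `C^n` diffeomorphism between the two
structures (Lee, *Introduction to Smooth Manifolds* (2013), Ch. 1, "smooth structures": any atlas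
compatible with a smooth atlas determines the same smooth structure; here the two atlases live on
different model spaces, so in Mathlib's typeclass set-up — `ChartedSpace H M` with `H` an
`outParam` — the transported structure must be carried by a type synonym).

This is pure bookkeeping, needed whenever a construction is only available for manifolds charted
on ONE fixed model space `E'` (e.g. a de Rham comparison family
`Literature.NumberTheory.Transcendental.ComplexDeRhamIsoFamily E'`, natural over the manifolds
charted on `E'`) and has to be applied to a manifold that comes charted on an isomorphic but
different model (a product `M × F`, an analytification charted on `ℂᵐ`, …). First consumer:
`Literature.AlgebraicGeometry.HodgeTheory.HodgeTypePullbackVanishing` (pull-backs of classes of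
Hodge type `(k, 0)` to varieties of dimension `< k` vanish).

## Content (all proved; no named facts)

* `Rechart f M` — the type synonym of `M` carrying the transported atlas
  `{c ≫ₕ f | c ∈ atlas H M}` (`Rechart.instChartedSpace`, `Rechart.chartAt_def`), with the
  topology (and separation / compactness / σ-compactness) of `M`; `Rechart.out`, `Rechart.into` are
  the identity maps to and from `M`.
* `Rechart.hasGroupoid`, `Rechart.isManifold` — if `f` and `f.symm` are `C^n` for `I` and
  `𝓘(𝕜, E')`, the transported atlas is `C^n`: its transition maps are the conjugates
  `f.symm ≫ₕ (c.symm ≫ₕ c') ≫ₕ f` of those of `M`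
  (`Literature.Topology.FourManifolds.symm_trans_trans_mem_contDiffGroupoid_of_homeomorph`).
* `Rechart.contMDiff_out`, `Rechart.contMDiff_into` — the identity is `C^n` in both directions
  (read in the charts `c ≫ₕ f` and `c` it is `f.symm`, resp. `f`).
* `Rechart.contMDiff_linear`, `Rechart.contMDiff_linear_symm` — the hypotheses for `f` the
  homeomorphism underlying a continuous linear isomorphism read through boundaryless models
  (`Literature.Topology.FourManifolds.Homeomorph.contMDiff_of_apply_eq_linear`).

## Mathlib and the tree

Mathlib (v4.32.0) has the change of model VECTOR space that keeps the model space `H` and the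
`ChartedSpace H M` structure — `ModelWithCorners.transContinuousLinearEquiv`, with
`ContinuousLinearEquiv.instIsManifoldtransContinuousLinearEquiv` and the identity diffeomorphism
`Diffeomorph.toTransContinuousLinearEquiv` (`Mathlib/Geometry/Manifold/Diffeomorph.lean`) — which
yields no `ChartedSpace E' M`, and the one-chart transport
`OpenPartialHomeomorph.singletonChartedSpace` / `ChartedSpace.comp`, without an `IsManifold`
statement for a change of model. A family indexed by "the manifolds charted on `E'`" consumes a
`ChartedSpace E'` structure, hence the present construction; its chart-level lemmas
(`symm_trans_trans_mem_contDiffGroupoid_of_homeomorph`, `Homeomorph.contMDiff_of_apply_eq_linear`)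
are the tree's `Literature.Topology.FourManifolds.GluingCharts` (gluing two pieces along a change
of model), specialised here to one piece.

## Relation to `Literature.Topology.FourManifolds.Recharted` (refactor note)

The tree already has the special case `𝕜 = ℝ`, `H = E` a normed space, `I = 𝓘(ℝ, E)`, `n = ∞`,
`f = L.toHomeomorph` for `L : E ≃L[ℝ] E'`: `Literature.Topology.FourManifolds.Recharted X L`
(`Topology/FourManifolds/Recharted.lean`: `rechart L c = ofHomeomorph.symm ≫ₕ c.transHomeomorph L`,
atlas `rechart L '' atlas E X`, `instIsManifold`, `contMDiff_of` / `contMDiff_of_symm`, the identity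
as a `Diffeomorph`, plus the transport of discs and orientations used by the connected-sum
uniqueness proofs). It cannot serve the present consumer: `Y^an × ℝ^{2n-2m}` comes charted on
`ModelProd B.model ℝ^{2n-2m}` with the model with corners `𝓘(ℝ, B.model).prod 𝓘(ℝ, ℝ^{2n-2m})`,
not on a normed space with `𝓘` (identifying the two is the discouraged defeq of
`modelWithCornersSelf_prod`), whence the generalisation here to an arbitrary model with corners
`(H, I)` on the source (and any field and regularity). Where both apply the two constructions
AGREE: for `f = L.toHomeomorph`, `Recharted.rechart L c` and `Rechart.chart f X c` are both
`L ∘ c` on `c.source` with inverse `c.symm ∘ L.symm` (`Rechart.chart_apply`, `chart_symm_apply`,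
`chart_source` versus `Recharted.rechart_apply`, `rechart_symm_apply`, `rechart_source`), so the two
atlases on the set `X` coincide. The bridge lemma is not stated in this file because of the
import direction: `Recharted.lean` imports the orientation and Gluck-twist development of
`Topology/FourManifolds` (`ChartTransport`, `SmoothOrientation`), which must stay out of the import
closure of this Mathlib-level file (it is imported by `AlgebraicGeometry/HodgeTheory`).
refactor: re-derive `Literature.Topology.FourManifolds.Recharted X L` as
`Rechart L.toHomeomorph X` (keeping its disc / orientation / `mfderiv` API, whose proofs go through
verbatim with `Rechart.chart_apply` etc.), and delete the duplicated atlas and smoothness proofs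
there.

## References

* J. M. Lee, *Introduction to Smooth Manifolds*, 2nd ed. (2013), Ch. 1 (Prop. 1.17, smooth
  structures determined by compatible atlases) and Lemma 1.35.
* M. W. Hirsch, *Differential Topology* (1976), Ch. 1 §1.
-/

noncomputable section

open scoped Manifold ContDiff Topology
open Set Function

namespace Literature.Geometry.Manifold

/-! ### The type synonym and its charted-space structure -/

section Topology

variable {H : Type*} [TopologicalSpace H] {E' : Type*} [TopologicalSpace E']

/-- `Rechart f M` is the type `M`; it carries the atlas of `M` transported along the homeomorphism
of model spaces `f : H ≃ₜ E'` (charts `c ≫ₕ f`, `Rechart.instChartedSpace`). A type synonym is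
needed because the model space is an `outParam` of `ChartedSpace`. (Bookkeeping for Mathlib's
formalism; cf. Lee 2013, Prop. 1.17: compatible atlases determine the same smooth structure.)
[folklore] -/
@[nolint unusedArguments]
def Rechart (_f : H ≃ₜ E') (M : Type*) : Type _ := M

namespace Rechart

variable (f : H ≃ₜ E') (M : Type*)

/-- The identity map `Rechart f M → M`. [folklore] -/
protected def out : Rechart f M → M := fun x ↦ x

/-- The identity map `M → Rechart f M`. [folklore] -/
protected def into : M → Rechart f M := fun x ↦ x

/-- `out ∘ into = id` (definitional). [folklore] -/
@[simp]
theorem out_into (x : M) : Rechart.out f M (Rechart.into f M x) = x :=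
  rfl

/-- `into ∘ out = id` (definitional). [folklore] -/
@[simp]
theorem into_out (x : Rechart f M) : Rechart.into f M (Rechart.out f M x) = x :=
  rfl

variable [TopologicalSpace M]

/-- `Rechart f M` has the topology of `M`. [folklore] -/
instance instTopologicalSpace : TopologicalSpace (Rechart f M) :=
  inferInstanceAs (TopologicalSpace M)

/-- `Rechart f M` is Hausdorff when `M` is. [folklore] -/
instance instT2Space [T2Space M] : T2Space (Rechart f M) :=
  inferInstanceAs (T2Space M)

/-- `Rechart f M` is compact when `M` is. [folklore] -/
instance instCompactSpace [CompactSpace M] : CompactSpace (Rechart f M) :=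
  inferInstanceAs (CompactSpace M)

/-- `Rechart f M` is σ-compact when `M` is. [folklore] -/
instance instSigmaCompactSpace [SigmaCompactSpace M] : SigmaCompactSpace (Rechart f M) :=
  inferInstanceAs (SigmaCompactSpace M)

/-- `Rechart f M` is locally compact when `M` is. [folklore] -/
instance instLocallyCompactSpace [LocallyCompactSpace M] : LocallyCompactSpace (Rechart f M) :=
  inferInstanceAs (LocallyCompactSpace M)

/-- The identity `Rechart f M → M` is continuous (same topology). [folklore] -/
theorem continuous_out : Continuous (Rechart.out f M) :=
  continuous_id

/-- The identity `M → Rechart f M` is continuous (same topology). [folklore] -/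
theorem continuous_into : Continuous (Rechart.into f M) :=
  continuous_id

/-- The identity `Rechart f M ≃ₜ M` as a homeomorphism. [folklore] -/
def outHomeomorph : Rechart f M ≃ₜ M where
  toFun := Rechart.out f M
  invFun := Rechart.into f M
  left_inv _ := rfl
  right_inv _ := rfl
  continuous_toFun := continuous_out f M
  continuous_invFun := continuous_into f M

/-- `outHomeomorph` is `Rechart.out` as a function. [folklore] -/
@[simp]
theorem coe_outHomeomorph : ⇑(outHomeomorph f M) = Rechart.out f M :=
  rfl

/-- The inverse of `outHomeomorph` is `Rechart.into`. [folklore] -/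
@[simp]
theorem coe_outHomeomorph_symm : ⇑(outHomeomorph f M).symm = Rechart.into f M :=
  rfl

/-- The chart `c` of `M` transported to `Rechart f M`: `out ≫ₕ c ≫ₕ f`, valued in `E'`. [folklore] -/
def chart (c : OpenPartialHomeomorph M H) : OpenPartialHomeomorph (Rechart f M) E' :=
  (outHomeomorph f M).toOpenPartialHomeomorph ≫ₕ c ≫ₕ f.toOpenPartialHomeomorph

/-- The transported chart as a function: `f ∘ c ∘ out`. [folklore] -/
@[simp]
theorem chart_apply (c : OpenPartialHomeomorph M H) (x : Rechart f M) :
    chart f M c x = f (c (Rechart.out f M x)) :=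
  rfl

/-- The inverse of the transported chart as a function: `into ∘ c.symm ∘ f.symm`. [folklore] -/
@[simp]
theorem chart_symm_apply (c : OpenPartialHomeomorph M H) (y : E') :
    (chart f M c).symm y = Rechart.into f M (c.symm (f.symm y)) :=
  rfl

/-- The source of the transported chart is (the copy of) the source of `c`. [folklore] -/
@[simp]
theorem chart_source (c : OpenPartialHomeomorph M H) :
    (chart f M c).source = Rechart.out f M ⁻¹' c.source := by
  simp [chart]

/-- The target of the transported chart is `f.symm ⁻¹' c.target`. [folklore] -/
@[simp]
theorem chart_target (c : OpenPartialHomeomorph M H) :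
    (chart f M c).target = f.symm ⁻¹' c.target := by
  simp [chart]

variable [ChartedSpace H M]

/-- **The transported atlas.** The charts of `Rechart f M` are the charts of `M` followed by the
homeomorphism of model spaces `f : H ≃ₜ E'` (and preceded by the identity `out`). (Cf. Lee 2013,
Prop. 1.17.) [folklore] -/
instance instChartedSpace : ChartedSpace E' (Rechart f M) where
  atlas := chart f M '' atlas H M
  chartAt x := chart f M (chartAt H (Rechart.out f M x))
  mem_chart_source x := by
    rw [chart_source, mem_preimage]
    exact mem_chart_source H (Rechart.out f M x)
  chart_mem_atlas x := mem_image_of_mem _ (chart_mem_atlas H (Rechart.out f M x))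

/-- The preferred chart of `Rechart f M` at `x` is the transported chart of `M` at `x`
(definitional). [folklore] -/
theorem chartAt_def (x : Rechart f M) :
    chartAt E' x = chart f M (chartAt H (Rechart.out f M x)) :=
  rfl

/-- Members of the transported atlas are the transported charts of `M`. [folklore] -/
theorem mem_atlas_iff {e : OpenPartialHomeomorph (Rechart f M) E'} :
    e ∈ atlas E' (Rechart f M) ↔ ∃ c : OpenPartialHomeomorph M H, c ∈ atlas H M ∧ chart f M c = e :=
  Iff.rfl

omit [ChartedSpace H M] in
/-- The transition map of two transported charts is the conjugate by `f` of the transition map of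
the original charts. [folklore] -/
theorem chart_symm_trans_chart (c c' : OpenPartialHomeomorph M H) :
    (chart f M c).symm ≫ₕ chart f M c' =
      f.toOpenPartialHomeomorph.symm ≫ₕ (c.symm ≫ₕ c') ≫ₕ f.toOpenPartialHomeomorph := by
  have h : (outHomeomorph f M).toOpenPartialHomeomorph.symm ≫ₕ
      (outHomeomorph f M).toOpenPartialHomeomorph = OpenPartialHomeomorph.refl M := by
    rw [← Homeomorph.symm_toOpenPartialHomeomorph, ← Homeomorph.trans_toOpenPartialHomeomorph,
      Homeomorph.symm_trans_self, Homeomorph.refl_toOpenPartialHomeomorph]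
  simp only [chart, OpenPartialHomeomorph.trans_symm_eq_symm_trans_symm,
    OpenPartialHomeomorph.trans_assoc]
  rw [← OpenPartialHomeomorph.trans_assoc (outHomeomorph f M).toOpenPartialHomeomorph.symm, h,
    OpenPartialHomeomorph.refl_trans]

end Rechart

end Topology

/-! ### Smoothness of the transported atlas -/

section Smooth

variable {𝕜 : Type*} [NontriviallyNormedField 𝕜]
  {E : Type*} [NormedAddCommGroup E] [NormedSpace 𝕜 E] {H : Type*} [TopologicalSpace H]
  {I : ModelWithCorners 𝕜 E H}
  {E' : Type*} [NormedAddCommGroup E'] [NormedSpace 𝕜 E'] {n : WithTop ℕ∞}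
  (f : H ≃ₜ E') (M : Type*) [TopologicalSpace M] [ChartedSpace H M]

namespace Rechart

/-- **The transported atlas is `C^n`.** If the change of model `f : H ≃ₜ E'` is `C^n` from `(H, I)`
to `(E', 𝓘(𝕜, E'))` with `C^n` inverse and `M` has the `C^n` structure groupoid for `I`, then
`Rechart f M` has the `C^n` structure groupoid for `𝓘(𝕜, E')`: the transition map of two
transported charts is `f.symm ≫ₕ (c.symm ≫ₕ c') ≫ₕ f` (`chart_symm_trans_chart`), the conjugate
of a transition map of `M`, hence `C^n` (cf. Lee 2013, Prop. 1.17 and Lemma 1.35). [folklore] -/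
theorem hasGroupoid [HasGroupoid M (contDiffGroupoid n I)] (hf : ContMDiff I 𝓘(𝕜, E') n f)
    (hf' : ContMDiff 𝓘(𝕜, E') I n f.symm) :
    HasGroupoid (Rechart f M) (contDiffGroupoid n 𝓘(𝕜, E')) where
  compatible := by
    rintro _ _ ⟨c, hc, rfl⟩ ⟨c', hc', rfl⟩
    rw [chart_symm_trans_chart]
    exact Literature.Topology.FourManifolds.symm_trans_trans_mem_contDiffGroupoid_of_homeomorph f
      hf hf' (HasGroupoid.compatible hc hc')

/-- **`Rechart f M` is a `C^n` manifold over `𝓘(𝕜, E')`** when `M` is a `C^n` manifold over `I`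
and `f`, `f.symm` are `C^n`. Not an instance (it has hypotheses); use `haveI`.
(Cf. Lee 2013, Prop. 1.17.) [folklore] -/
theorem isManifold [IsManifold I n M] (hf : ContMDiff I 𝓘(𝕜, E') n f)
    (hf' : ContMDiff 𝓘(𝕜, E') I n f.symm) : IsManifold 𝓘(𝕜, E') n (Rechart f M) :=
  haveI := hasGroupoid f M hf hf'
  IsManifold.mk' _ _ _

/-- **The identity `Rechart f M → M` is `C^n`**: on the source of the chart `c` of `M` at `x` it
is `c.symm ∘ f.symm ∘ (transported chart)`, a composite of `C^n` maps (i.e. the two atlases on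
the set `M` are `C^n`-compatible through `f`; cf. Lee 2013, Prop. 1.17). [folklore] -/
theorem contMDiff_out [IsManifold I n M] (hf : ContMDiff I 𝓘(𝕜, E') n f)
    (hf' : ContMDiff 𝓘(𝕜, E') I n f.symm) : ContMDiff 𝓘(𝕜, E') I n (Rechart.out f M) := by
  haveI := isManifold f M hf hf'
  intro x
  set c := chartAt H (Rechart.out f M x) with hc
  have h1 : ContMDiffOn 𝓘(𝕜, E') 𝓘(𝕜, E') n (chartAt E' x) (chartAt E' x).source :=
    contMDiffOn_chart
  have h2 : ContMDiffOn 𝓘(𝕜, E') I n (f.symm ∘ chartAt E' x) (chartAt E' x).source :=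
    hf'.comp_contMDiffOn h1
  have h3 : ContMDiffOn I I n c.symm c.target := contMDiffOn_chart_symm
  have hsrc : (chartAt E' x).source = Rechart.out f M ⁻¹' c.source := by
    rw [chartAt_def, chart_source]
  have h4 : ContMDiffOn 𝓘(𝕜, E') I n (c.symm ∘ (f.symm ∘ chartAt E' x)) (chartAt E' x).source := by
    refine h3.comp h2 fun y hy ↦ ?_
    rw [hsrc, mem_preimage] at hy
    rw [mem_preimage, comp_apply, chartAt_def, chart_apply, Homeomorph.symm_apply_apply]
    exact c.map_source hy
  have heq : ∀ y ∈ (chartAt E' x).source,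
      Rechart.out f M y = (c.symm ∘ (f.symm ∘ chartAt E' x)) y := by
    intro y hy
    rw [hsrc, mem_preimage] at hy
    rw [comp_apply, comp_apply, chartAt_def, chart_apply, Homeomorph.symm_apply_apply,
      c.left_inv hy]
  exact (h4.congr heq).contMDiffAt ((chartAt E' x).open_source.mem_nhds (mem_chart_source E' x))

/-- **The identity `M → Rechart f M` is `C^n`**: on the source of the chart `c` of `M` at `x` it
is `(transported chart).symm ∘ f ∘ c` (cf. Lee 2013, Prop. 1.17). [folklore] -/
theorem contMDiff_into [IsManifold I n M] (hf : ContMDiff I 𝓘(𝕜, E') n f)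
    (hf' : ContMDiff 𝓘(𝕜, E') I n f.symm) : ContMDiff I 𝓘(𝕜, E') n (Rechart.into f M) := by
  haveI := isManifold f M hf hf'
  intro x
  set c := chartAt H x with hc
  set c' : OpenPartialHomeomorph (Rechart f M) E' := chartAt E' (Rechart.into f M x) with hc'
  have hcc' : c' = chart f M c := rfl
  have h1 : ContMDiffOn I I n c c.source := contMDiffOn_chart
  have h2 : ContMDiffOn I 𝓘(𝕜, E') n (f ∘ c) c.source := hf.comp_contMDiffOn h1
  have h3 : ContMDiffOn 𝓘(𝕜, E') 𝓘(𝕜, E') n c'.symm c'.target := contMDiffOn_chart_symm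
  have h4 : ContMDiffOn I 𝓘(𝕜, E') n (c'.symm ∘ (f ∘ c)) c.source := by
    refine h3.comp h2 fun y hy ↦ ?_
    simp only [mem_preimage, hcc', chart_target, comp_apply, Homeomorph.symm_apply_apply]
    exact c.map_source hy
  have heq : ∀ y ∈ c.source, Rechart.into f M y = (c'.symm ∘ (f ∘ c)) y := by
    intro y hy
    rw [comp_apply, comp_apply, hcc', chart_symm_apply, Homeomorph.symm_apply_apply, c.left_inv hy]
  exact (h4.congr heq).contMDiffAt (c.open_source.mem_nhds (mem_chart_source H x))

/-- The change of model underlying a continuous linear isomorphism `L : E ≃L[𝕜] E'` read through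
the model with corners `I` (`f x = L (I x)`) is `C^n`
(`Literature.Topology.FourManifolds.Homeomorph.contMDiff_of_apply_eq_linear`). [folklore] -/
theorem contMDiff_of_apply_eq_linear (L : E ≃L[𝕜] E') (hIf : ∀ x, f x = L (I x)) :
    ContMDiff I 𝓘(𝕜, E') n f :=
  Literature.Topology.FourManifolds.Homeomorph.contMDiff_of_apply_eq_linear f L
    (fun x ↦ by rw [modelWithCornersSelf_coe, id_eq]; exact hIf x)

/-- The inverse change of model is `C^n` as well (`I (f.symm y) = L.symm y`). [folklore] -/
theorem contMDiff_symm_of_apply_eq_linear (L : E ≃L[𝕜] E') (hIf : ∀ x, f x = L (I x)) :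
    ContMDiff 𝓘(𝕜, E') I n f.symm :=
  Literature.Topology.FourManifolds.Homeomorph.contMDiff_of_apply_eq_linear f.symm L.symm
    (fun y ↦ by
      rw [modelWithCornersSelf_coe, id_eq]
      exact Literature.Topology.FourManifolds.Homeomorph.symm_apply_eq_linear f L
        (fun x ↦ by rw [modelWithCornersSelf_coe, id_eq]; exact hIf x) y)

end Rechart

end Smooth

end Literature.Geometry.Manifold

end
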